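import Summits.KontsevichZagierPeriods.KontsevichZagierPeriods.Theorems.SymplecticScissorsVolumeFormOffPlaneSimplexSector

/-!
# `VolumeFormOffPlane` (stmt-KontsevichZagierPeriods-14935) — line `Sketch`,
stub `stub_binomialSector` (the mixed binomial-cell/box sector in every dimension, bookkeeping)

Given (1) `binomial cell ~ box` in box-dimension `n + 1` (the binomial cell
`{0 < x, a_k < ∏_j x_j ^ M_{kj}, ∏_k ∏_j x_j ^ M_{kj} < c, slack}` with `det M ≠ 0` is
KZ-equivalent to the log-box at the corner `(1, …, 1)` with edge ratios `(γ, g, …, g)`,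
`g = c / ∏ a_ι`, `γ = g ^ (1 / (|det M| (n + 1)!))`) and (2) the rank-two toric box sector in
real-algebraic position (every box-dimension), two MIXED finite families of log-boxes and
binomial cells in total dimension `n + 2` with equal total value are KZ-equivalent as formal sums.

Proof: replace every cell `S_ν` by its box `B_ν` (it exists by `stub_logBoxCut.1`; (1) gives
`[S_ν] − [B_ν] ∈ relations`, so the values agree by soundness of the calculus); with
`c_ν = (∏ a_ν) · αᵘ βᵛ` the edge ratios of `B_ν` are `g = αᵘ βᵛ` in every coordinate but the
first, where it is `g ^ (1 / N) = α^{u / N} β^{v / N}`, `N = |det M_ν| (n + 1)!` — again in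
`α^ℚ β^ℚ` and `> 1`. Feed (2) at box-dimension `n + 1` with the enlarged box families (indexed by
`Fin (k + m)` through `Fin.append`) and add back the cell/box differences.

Sources: Kontsevich–Zagier 2001, §1.2 (soundness of the moves).
-/

noncomputable section

open MeasureTheory Set
open Literature.NumberTheory.Transcendental

namespace Summit.KontsevichZagierPeriods.SymplecticScissors.LogPolytope

/-! ## The corners of the box replacing a binomial cell -/

/-- The upper corners of the box replacing the binomial cell with data `(M, a, c)`,
`c = (∏ a_ι) αᵘ βᵛ`: `(g, …, g)[0 ↦ g ^ (1 / (d (n + 1)!))]_ι` with `g = c / ∏ a_ι = αᵘ βᵛ`,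
i.e. the corner `1` times the edge ratios `α^{U} β^{V}` with `U = (u, …, u)[0 ↦ u / (d (n + 1)!)]`,
`V = (v, …, v)[0 ↦ v / (d (n + 1)!)]`. [folklore] -/
theorem bsc_corner {n d : ℕ} {α β tc : ℝ} {ta : Fin (n + 1) → ℝ} {tu tv : ℚ} (hα : 0 ≤ α)
    (hβ : 0 ≤ β) (hta : ∀ ι, 0 < ta ι)
    (htc : tc = (∏ ι, ta ι) * (α ^ ((tu : ℚ) : ℝ) * β ^ ((tv : ℚ) : ℝ))) (ι : Fin (n + 1)) :
    Function.update (fun _ : Fin (n + 1) => tc / ∏ κ, ta κ) 0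
        ((tc / ∏ κ, ta κ) ^ (((d * (n + 1).factorial : ℕ) : ℝ)⁻¹)) ι =
      1 * (α ^ ((Function.update (fun _ : Fin (n + 1) => tu) 0
          (tu / ((d * (n + 1).factorial : ℕ) : ℚ)) ι : ℚ) : ℝ) *
        β ^ ((Function.update (fun _ : Fin (n + 1) => tv) 0
          (tv / ((d * (n + 1).factorial : ℕ) : ℚ)) ι : ℚ) : ℝ)) := by
  have hP : (0 : ℝ) < ∏ κ, ta κ := Finset.prod_pos fun κ _ => hta κ
  have hg : tc / ∏ κ, ta κ = α ^ ((tu : ℚ) : ℝ) * β ^ ((tv : ℚ) : ℝ) := by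
    rw [htc, mul_div_cancel_left₀ _ hP.ne']
  rw [one_mul]
  rcases eq_or_ne ι 0 with rfl | hι
  · simp only [Function.update_self, hg, mxs_root_eq hα hβ]
  · simp only [Function.update_of_ne hι, hg]

/-- The box replacing a binomial cell, written with corner `1` and edge ratios `α^{U} β^{V}` (the
shape of the box sector) and written with the corners `(g, …, g)[0 ↦ g ^ (1 / (d (n + 1)!))]`,
`g = c / ∏ a_ι` (the shape of `binomial cell ~ box`), is the same set. [folklore] -/
theorem bsc_box_eq {n d : ℕ} {α β tc : ℝ} {ta : Fin (n + 1) → ℝ} {tu tv : ℚ} (hα : 0 ≤ α)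
    (hβ : 0 ≤ β) (hta : ∀ ι, 0 < ta ι)
    (htc : tc = (∏ ι, ta ι) * (α ^ ((tu : ℚ) : ℝ) * β ^ ((tv : ℚ) : ℝ))) :
    {p : Fin (n + 1 + 1) → ℝ | (∀ j : Fin (n + 1), 1 < p (Fin.castSucc j) ∧
        p (Fin.castSucc j) < 1 * (α ^ ((Function.update (fun _ : Fin (n + 1) => tu) 0
            (tu / ((d * (n + 1).factorial : ℕ) : ℚ)) j : ℚ) : ℝ) *
          β ^ ((Function.update (fun _ : Fin (n + 1) => tv) 0
            (tv / ((d * (n + 1).factorial : ℕ) : ℚ)) j : ℚ) : ℝ))) ∧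
        0 < p (Fin.last (n + 1)) ∧
        p (Fin.last (n + 1)) * ∏ j : Fin (n + 1), p (Fin.castSucc j) < 1} =
      {p : Fin ((n + 1) + 1) → ℝ | (∀ ι : Fin (n + 1), (fun _ => (1:ℝ)) ι < p (Fin.castSucc ι) ∧
        p (Fin.castSucc ι) < (Function.update (fun _ : Fin (n + 1) => tc / ∏ κ, ta κ) 0
          ((tc / ∏ κ, ta κ) ^ (((d * (n + 1).factorial : ℕ) : ℝ)⁻¹))) ι) ∧
        0 < p (Fin.last (n + 1)) ∧
        p (Fin.last (n + 1)) * ∏ ι : Fin (n + 1), p (Fin.castSucc ι) < 1} := by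
  ext p
  simp only [Set.mem_setOf_eq, bsc_corner hα hβ hta htc]

/-! ## One side: replacing the binomial cells of a mixed family by boxes -/

/-- **One side of the mixed binomial-cell/box sector.** Given `binomial cell ~ box` in
box-dimension `n + 1`, a mixed family of `k` log-boxes (position form, edge ratios `αᵘ βᵛ > 1`)
and `m` binomial cells (`det M ≠ 0`, `c = (∏ a_ι) αᵘ βᵛ`, ratio `> 1`) is, as a formal sum,
KZ-equivalent to a family of `k + m` log-boxes of the same shape with the same total value.
[folklore] -/
theorem bsc_side {n : ℕ}
    (hCell : ∀ (M : Matrix (Fin (n + 1)) (Fin (n + 1)) ℤ) (a : Fin (n + 1) → ℝ) (c : ℝ),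
      M.det ≠ 0 → (∀ ι, 0 < a ι) → (∀ ι, IsAlgebraic ℚ (a ι)) → IsAlgebraic ℚ c → ∏ ι, a ι < c →
      ∀ (r r' : KZ.IntegralRep (n + 1 + 1)),
      r.domain = {p : Fin ((n + 1) + 1) → ℝ | (∀ ι : Fin (n + 1), 0 < p (Fin.castSucc ι)) ∧
        (∀ k : Fin (n + 1), (a) k < ∏ j : Fin (n + 1), p (Fin.castSucc j) ^ (M k j)) ∧
        ∏ k : Fin (n + 1), ∏ j : Fin (n + 1), p (Fin.castSucc j) ^ (M k j) < c ∧
        0 < p (Fin.last (n + 1)) ∧ p (Fin.last (n + 1)) * ∏ ι : Fin (n + 1), p (Fin.castSucc ι) < 1} →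
      r'.domain = {p : Fin ((n + 1) + 1) → ℝ | (∀ ι : Fin (n + 1), (fun _ => (1:ℝ)) ι < p (Fin.castSucc ι) ∧
        p (Fin.castSucc ι) < (Function.update (fun _ : Fin (n + 1) => c / ∏ κ, a κ) 0
          ((c / ∏ κ, a κ) ^ (((M.det.natAbs * (n + 1).factorial : ℕ) : ℝ)⁻¹))) ι) ∧
        0 < p (Fin.last (n + 1)) ∧ p (Fin.last (n + 1)) * ∏ ι : Fin (n + 1), p (Fin.castSucc ι) < 1} →
      (∀ p ∈ r.domain, r.integrand p = 1) → (∀ p ∈ r'.domain, r'.integrand p = 1) →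
      KZ.of r - KZ.of r' ∈ KZ.relations)
    {α β : ℝ} (hα : 0 < α) (hβ : 0 < β) (hαa : IsAlgebraic ℚ α) (hβa : IsAlgebraic ℚ β)
    {k m : ℕ} {a : Fin k → Fin (n + 1) → ℝ} {u v : Fin k → Fin (n + 1) → ℚ}
    {sM : Fin m → Matrix (Fin (n + 1)) (Fin (n + 1)) ℤ}
    {sa : Fin m → Fin (n + 1) → ℝ} {sc : Fin m → ℝ} {su sv : Fin m → ℚ}
    {rB : Fin k → KZ.IntegralRep (n + 1 + 1)} {rS : Fin m → KZ.IntegralRep (n + 1 + 1)}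
    (ha : ∀ i j, 0 < a i j) (haa : ∀ i j, IsAlgebraic ℚ (a i j))
    (hlt : ∀ i j, 1 < α ^ ((u i j : ℚ) : ℝ) * β ^ ((v i j : ℚ) : ℝ))
    (hrBd : ∀ i, (rB i).domain = {p : Fin (n + 1 + 1) → ℝ | (∀ j : Fin (n + 1),
      a i j < p (Fin.castSucc j) ∧
      p (Fin.castSucc j) < a i j * (α ^ ((u i j : ℚ) : ℝ) * β ^ ((v i j : ℚ) : ℝ))) ∧
      0 < p (Fin.last (n + 1)) ∧ p (Fin.last (n + 1)) * ∏ j : Fin (n + 1), p (Fin.castSucc j) < 1})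
    (hrBi : ∀ i, ∀ p ∈ (rB i).domain, (rB i).integrand p = 1)
    (hdet : ∀ ν, ((sM) ν).det ≠ 0)
    (hsa : ∀ ν ι, 0 < sa ν ι) (hsaa : ∀ ν ι, IsAlgebraic ℚ (sa ν ι))
    (hsca : ∀ ν, IsAlgebraic ℚ (sc ν))
    (hsc : ∀ ν, sc ν = (∏ ι, sa ν ι) * (α ^ ((su ν : ℚ) : ℝ) * β ^ ((sv ν : ℚ) : ℝ)))
    (hltS : ∀ ν, 1 < α ^ ((su ν : ℚ) : ℝ) * β ^ ((sv ν : ℚ) : ℝ))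
    (hrSd : ∀ ν, (rS ν).domain = {p : Fin ((n + 1) + 1) → ℝ |
      (∀ ι : Fin (n + 1), 0 < p (Fin.castSucc ι)) ∧
      (∀ k : Fin (n + 1), (sa ν) k < ∏ j : Fin (n + 1), p (Fin.castSucc j) ^ (sM ν k j)) ∧
      ∏ k : Fin (n + 1), ∏ j : Fin (n + 1), p (Fin.castSucc j) ^ (sM ν k j) < sc ν ∧
      0 < p (Fin.last (n + 1)) ∧ p (Fin.last (n + 1)) * ∏ ι : Fin (n + 1), p (Fin.castSucc ι) < 1})
    (hrSi : ∀ ν, ∀ p ∈ (rS ν).domain, (rS ν).integrand p = 1) :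
    ∃ (A : Fin (k + m) → Fin (n + 1) → ℝ) (U V : Fin (k + m) → Fin (n + 1) → ℚ)
      (R : Fin (k + m) → KZ.IntegralRep (n + 1 + 1)),
      (∀ i j, 0 < A i j) ∧ (∀ i j, IsAlgebraic ℚ (A i j)) ∧
      (∀ i j, 1 < α ^ ((U i j : ℚ) : ℝ) * β ^ ((V i j : ℚ) : ℝ)) ∧
      (∀ i, (R i).domain = {p : Fin (n + 1 + 1) → ℝ | (∀ j : Fin (n + 1),
        A i j < p (Fin.castSucc j) ∧
        p (Fin.castSucc j) < A i j * (α ^ ((U i j : ℚ) : ℝ) * β ^ ((V i j : ℚ) : ℝ))) ∧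
        0 < p (Fin.last (n + 1)) ∧
        p (Fin.last (n + 1)) * ∏ j : Fin (n + 1), p (Fin.castSucc j) < 1}) ∧
      (∀ i, ∀ p ∈ (R i).domain, (R i).integrand p = 1) ∧
      ∑ i, (R i).value = ∑ ν, (rB ν).value + ∑ ν, (rS ν).value ∧
      ∑ i, KZ.of (R i) - (∑ ν, KZ.of (rB ν) + ∑ ν, KZ.of (rS ν)) ∈ KZ.relations := by
  have hcor : ∀ uu vv : ℚ, IsAlgebraic ℚ (α ^ ((uu : ℚ) : ℝ) * β ^ ((vv : ℚ) : ℝ)) :=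
    fun uu vv => (mxs_rpow_isAlgebraic hα hαa uu).mul (mxs_rpow_isAlgebraic hβ hβa vv)
  have h1a : IsAlgebraic ℚ (1 : ℝ) := isAlgebraic_one
  have hN : ∀ ν, (0 : ℝ) < (((sM ν).det.natAbs * (n + 1).factorial : ℕ) : ℝ) := fun ν =>
    Nat.cast_pos.mpr (Nat.mul_pos (Int.natAbs_pos.mpr (hdet ν)) (Nat.factorial_pos _))
  -- the ratios `α^{U ν j} β^{V ν j}` of the replacement boxes exceed `1`
  have hSlt : ∀ ν, ∀ j : Fin (n + 1),
      1 < α ^ ((Function.update (fun _ : Fin (n + 1) => su ν) 0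
          (su ν / (((sM ν).det.natAbs * (n + 1).factorial : ℕ) : ℚ)) j : ℚ) : ℝ) *
        β ^ ((Function.update (fun _ : Fin (n + 1) => sv ν) 0
          (sv ν / (((sM ν).det.natAbs * (n + 1).factorial : ℕ) : ℚ)) j : ℚ) : ℝ) := by
    intro ν j
    rcases eq_or_ne j 0 with rfl | hj
    · simp only [Function.update_self]
      rw [mxs_root_eq hα.le hβ.le]
      exact Real.one_lt_rpow (hltS ν) (inv_pos.mpr (hN ν))
    · simp only [Function.update_of_ne hj]
      exact hltS ν
  -- the replacement boxes
  have hexS : ∀ ν : Fin m, ∃ r : KZ.IntegralRep (n + 1 + 1),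
      r.domain = {p : Fin (n + 1 + 1) → ℝ | (∀ j : Fin (n + 1), 1 < p (Fin.castSucc j) ∧
        p (Fin.castSucc j) < 1 *
          (α ^ ((Function.update (fun _ : Fin (n + 1) => su ν) 0
              (su ν / (((sM ν).det.natAbs * (n + 1).factorial : ℕ) : ℚ)) j : ℚ) : ℝ) *
            β ^ ((Function.update (fun _ : Fin (n + 1) => sv ν) 0
              (sv ν / (((sM ν).det.natAbs * (n + 1).factorial : ℕ) : ℚ)) j : ℚ) : ℝ))) ∧
        0 < p (Fin.last (n + 1)) ∧
        p (Fin.last (n + 1)) * ∏ j : Fin (n + 1), p (Fin.castSucc j) < 1} ∧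
      r.integrand = fun _ => 1 := fun ν =>
    stub_logBoxCut.1 (n + 1) (fun _ => 1) (fun j => 1 *
      (α ^ ((Function.update (fun _ : Fin (n + 1) => su ν) 0
          (su ν / (((sM ν).det.natAbs * (n + 1).factorial : ℕ) : ℚ)) j : ℚ) : ℝ) *
        β ^ ((Function.update (fun _ : Fin (n + 1) => sv ν) 0
          (sv ν / (((sM ν).det.natAbs * (n + 1).factorial : ℕ) : ℚ)) j : ℚ) : ℝ)))
      (fun _ => one_pos) (fun _ => h1a) (fun _ => h1a.mul (hcor _ _))
  choose bS hbSd hbSi using hexS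
  have hbSi' : ∀ ν, ∀ p ∈ (bS ν).domain, (bS ν).integrand p = 1 := fun ν p _ => by
    rw [hbSi ν]
  -- `binomial cell ~ box`, and equality of values by soundness of the calculus
  have hSB : ∀ ν, KZ.of (rS ν) - KZ.of (bS ν) ∈ KZ.relations := fun ν => by
    have hP : (0 : ℝ) < ∏ ι, sa ν ι := Finset.prod_pos fun ι _ => hsa ν ι
    refine hCell (sM ν) (sa ν) (sc ν) (hdet ν) (hsa ν) (hsaa ν) (hsca ν) ?_ (rS ν) (bS ν)
      (hrSd ν) ?_ (hrSi ν) (hbSi' ν)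
    · rw [hsc ν]
      exact lt_mul_of_one_lt_right hP (hltS ν)
    · rw [hbSd ν]
      exact bsc_box_eq hα.le hβ.le (hsa ν) (hsc ν)
  have hval : ∀ ν, (bS ν).value = (rS ν).value := fun ν =>
    (KZ.Equivalent.value_eq_holds (hSB ν)).symm
  -- the enlarged box family
  refine ⟨Fin.append a (fun _ _ => 1),
    Fin.append u (fun ν => Function.update (fun _ : Fin (n + 1) => su ν) 0
      (su ν / (((sM ν).det.natAbs * (n + 1).factorial : ℕ) : ℚ))),
    Fin.append v (fun ν => Function.update (fun _ : Fin (n + 1) => sv ν) 0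
      (sv ν / (((sM ν).det.natAbs * (n + 1).factorial : ℕ) : ℚ))),
    Fin.append rB bS, ?_, ?_, ?_, ?_, ?_, ?_, ?_⟩
  · intro i
    induction i using Fin.addCases with
    | left i => simp only [Fin.append_left]; exact ha i
    | right ν => simp only [Fin.append_right]; exact fun _ => one_pos
  · intro i
    induction i using Fin.addCases with
    | left i => simp only [Fin.append_left]; exact haa i
    | right ν => simp only [Fin.append_right]; exact fun _ => h1a
  · intro i
    induction i using Fin.addCases with
    | left i => simp only [Fin.append_left]; exact hlt i
    | right ν => simp only [Fin.append_right]; exact hSlt ν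
  · intro i
    induction i using Fin.addCases with
    | left i => simp only [Fin.append_left]; exact hrBd i
    | right ν => simp only [Fin.append_right]; exact hbSd ν
  · intro i
    induction i using Fin.addCases with
    | left i => simp only [Fin.append_left]; exact hrBi i
    | right ν => simp only [Fin.append_right]; exact hbSi' ν
  · simp only [Fin.sum_univ_add, Fin.append_left, Fin.append_right, hval]
  · rw [Fin.sum_univ_add]
    simp only [Fin.append_left, Fin.append_right]
    have : ∑ i, KZ.of (rB i) + ∑ ν, KZ.of (bS ν) - (∑ ν, KZ.of (rB ν) + ∑ ν, KZ.of (rS ν)) =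
        ∑ ν, (KZ.of (bS ν) - KZ.of (rS ν)) := by
      rw [Finset.sum_sub_distrib]; abel
    rw [this]
    exact sum_mem fun ν _ => by rw [← neg_sub]; exact KZ.relations.neg_mem (hSB ν)

/-! ## The stub -/

/-- **Stub (the mixed binomial-cell/box sector in every dimension, bookkeeping).** Given
`stub_binomialCellToBox`'s conclusion and the landed position-form box sector: for `α, β > 0` real
algebraic and multiplicatively independent, two mixed finite families of log-boxes (real-algebraic
position, edge ratios in `α^ℚ β^ℚ`, `> 1`) and binomial cells (`det M ≠ 0`,
`c = (∏ a_ι) · α^u β^v`, `u, v ∈ ℚ`, ratio `> 1`) in dimension `n + 2` with equal total value are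
KZ-equivalent as formal sums (replace every cell by its box at the corner `1` — values are
preserved by soundness — and apply the box sector to the enlarged box families). [folklore] -/
theorem stub_binomialSector : (∀ (n : ℕ) (M : Matrix (Fin (n + 1)) (Fin (n + 1)) ℤ) (a : Fin (n + 1) → ℝ) (c : ℝ), M.det ≠ 0 → (∀ ι, 0 < a ι) → (∀ ι, IsAlgebraic ℚ (a ι)) → IsAlgebraic ℚ c → ∏ ι, a ι < c → ∀ (r r' : KZ.IntegralRep (n + 1 + 1)), r.domain = {p : Fin ((n + 1) + 1) → ℝ | (∀ ι : Fin (n + 1), 0 < p (Fin.castSucc ι)) ∧ (∀ k : Fin (n + 1), (a) k < ∏ j : Fin (n + 1), p (Fin.castSucc j) ^ (M k j)) ∧ ∏ k : Fin (n + 1), ∏ j : Fin (n + 1), p (Fin.castSucc j) ^ (M k j) < c ∧ 0 < p (Fin.last (n + 1)) ∧ p (Fin.last (n + 1)) * ∏ ι : Fin (n + 1), p (Fin.castSucc ι) < 1} → r'.domain = {p : Fin ((n + 1) + 1) → ℝ | (∀ ι : Fin (n + 1), (fun _ => (1:ℝ)) ι < p (Fin.castSucc ι) ∧ p (Fin.castSucc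 ι) < (Function.update (fun _ : Fin (n + 1) => c / ∏ κ, a κ) 0 ((c / ∏ κ, a κ) ^ (((M.det.natAbs * (n + 1).factorial : ℕ) : ℝ)⁻¹))) ι) ∧ 0 < p (Fin.last (n + 1)) ∧ p (Fin.last (n + 1)) * ∏ ι : Fin (n + 1), p (Fin.castSucc ι) < 1} → (∀ p ∈ r.domain, r.integrand p = 1) → (∀ p ∈ r'.domain, r'.integrand p = 1) → KZ.of r - KZ.of r' ∈ KZ.relations) → (∀ (n : ℕ) (α β : ℝ), 0 < α → 0 < β → IsAlgebraic ℚ α → IsAlgebraic ℚ β → (∀ p q : ℤ, α ^ p * β ^ q = 1 → p = 0 ∧ q = 0) → ∀ (k k' : ℕ) (a : Fin k → Fin n → ℝ) (u v : Fin k → Fin n → ℚ) (a' : Fin k' → Fin n → ℝ) (s t : Fin k' → Fin n → ℚ) (r : Fin k → KZ.IntegralRep (n + 1)) (r' : Fin k' → KZ.IntegralRep (n + 1)), (∀ i j, 0 < a i j) → (∀ i j, IsAlgebraic ℚ (a i j)) → (∀ i j, 1 < α ^ ((u i j : ℚ) : ℝ) * β ^ ((v i j : ℚ) : ℝ)) →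 (∀ i j, 0 < a' i j) → (∀ i j, IsAlgebraic ℚ (a' i j)) → (∀ i j, 1 < α ^ ((s i j : ℚ) : ℝ) * β ^ ((t i j : ℚ) : ℝ)) → (∀ i, (r i).domain = {p : Fin (n + 1) → ℝ | (∀ j : Fin n, a i j < p (Fin.castSucc j) ∧ p (Fin.castSucc j) < a i j * (α ^ ((u i j : ℚ) : ℝ) * β ^ ((v i j : ℚ) : ℝ))) ∧ 0 < p (Fin.last n) ∧ p (Fin.last n) * ∏ j : Fin n, p (Fin.castSucc j) < 1}) → (∀ i, ∀ p ∈ (r i).domain, (r i).integrand p = 1) → (∀ i, (r' i).domain = {p : Fin (n + 1) → ℝ | (∀ j : Fin n, a' i j < p (Fin.castSucc j) ∧ p (Fin.castSucc j) < a' i j * (α ^ ((s i j : ℚ) : ℝ) * β ^ ((t i j : ℚ) : ℝ))) ∧ 0 < p (Fin.last n) ∧ p (Fin.last n) * ∏ j : Fin n, p (Fin.castSucc j) < 1}) → (∀ i, ∀ p ∈ (r' i).domain, (r' i).integrand p = 1) → ∑ i, (r i).value = ∑ i, (r' i).value → ∑ i, KZ.of (r i) - ∑ i, KZ.of (r' i)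 ∈ KZ.relations) → (∀ (n : ℕ) (α β : ℝ), 0 < α → 0 < β → IsAlgebraic ℚ α → IsAlgebraic ℚ β → (∀ p q : ℤ, α ^ p * β ^ q = 1 → p = 0 ∧ q = 0) → ∀ (k m k' m' : ℕ) (a : Fin k → Fin (n + 1) → ℝ) (u v : Fin k → Fin (n + 1) → ℚ) (sM : Fin m → Matrix (Fin (n + 1)) (Fin (n + 1)) ℤ) (sa : Fin m → Fin (n + 1) → ℝ) (sc : Fin m → ℝ) (su sv : Fin m → ℚ) (a' : Fin k' → Fin (n + 1) → ℝ) (u' v' : Fin k' → Fin (n + 1) → ℚ) (sM' : Fin m' → Matrix (Fin (n + 1)) (Fin (n + 1)) ℤ) (sa' : Fin m' → Fin (n + 1) → ℝ) (sc' : Fin m' → ℝ) (su' sv' : Fin m' → ℚ) (rB : Fin k → KZ.IntegralRep (n + 1 + 1)) (rS : Fin m → KZ.IntegralRep (n + 1 + 1)) (rB' : Fin k' → KZ.IntegralRep (n + 1 + 1)) (rS' : Fin m' → KZ.IntegralRep (n + 1 + 1)), (∀ i j, 0 < a i j) → (∀ i j, IsAlgebraic ℚ (a i j)) → (∀ i j,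 1 < α ^ ((u i j : ℚ) : ℝ) * β ^ ((v i j : ℚ) : ℝ)) → (∀ i, (rB i).domain = {p : Fin (n + 1 + 1) → ℝ | (∀ j : Fin (n + 1), a i j < p (Fin.castSucc j) ∧ p (Fin.castSucc j) < a i j * (α ^ ((u i j : ℚ) : ℝ) * β ^ ((v i j : ℚ) : ℝ))) ∧ 0 < p (Fin.last (n + 1)) ∧ p (Fin.last (n + 1)) * ∏ j : Fin (n + 1), p (Fin.castSucc j) < 1}) → (∀ i, ∀ p ∈ (rB i).domain, (rB i).integrand p = 1) → (∀ ν, ((sM) ν).det ≠ 0) → (∀ ν ι, 0 < sa ν ι) → (∀ ν ι, IsAlgebraic ℚ (sa ν ι)) → (∀ ν, IsAlgebraic ℚ (sc ν)) → (∀ ν, sc ν = (∏ ι, sa ν ι) * (α ^ ((su ν : ℚ) : ℝ) * β ^ ((sv ν : ℚ) : ℝ))) → (∀ ν, 1 < α ^ ((su ν : ℚ) : ℝ) * β ^ ((sv ν : ℚ) : ℝ)) → (∀ ν, (rS ν).domain = {p : Fin ((n + 1) + 1) → ℝ | (∀ ι : Fin (n + 1), 0 < p (Fin.castSucc ι)) ∧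 (∀ k : Fin (n + 1), (sa ν) k < ∏ j : Fin (n + 1), p (Fin.castSucc j) ^ (sM ν k j)) ∧ ∏ k : Fin (n + 1), ∏ j : Fin (n + 1), p (Fin.castSucc j) ^ (sM ν k j) < sc ν ∧ 0 < p (Fin.last (n + 1)) ∧ p (Fin.last (n + 1)) * ∏ ι : Fin (n + 1), p (Fin.castSucc ι) < 1}) → (∀ ν, ∀ p ∈ (rS ν).domain, (rS ν).integrand p = 1) → (∀ i j, 0 < a' i j) → (∀ i j, IsAlgebraic ℚ (a' i j)) → (∀ i j, 1 < α ^ ((u' i j : ℚ) : ℝ) * β ^ ((v' i j : ℚ) : ℝ)) → (∀ i, (rB' i).domain = {p : Fin (n + 1 + 1) → ℝ | (∀ j : Fin (n + 1), a' i j < p (Fin.castSucc j) ∧ p (Fin.castSucc j) < a' i j * (α ^ ((u' i j : ℚ) : ℝ) * β ^ ((v' i j : ℚ) : ℝ))) ∧ 0 < p (Fin.last (n + 1)) ∧ p (Fin.last (n + 1)) * ∏ j : Fin (n + 1), p (Fin.castSucc j) < 1}) → (∀ i, ∀ p ∈ (rB' i).domain, (rB' i).integrand p = 1) → (∀ ν,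 ((sM') ν).det ≠ 0) → (∀ ν ι, 0 < sa' ν ι) → (∀ ν ι, IsAlgebraic ℚ (sa' ν ι)) → (∀ ν, IsAlgebraic ℚ (sc' ν)) → (∀ ν, sc' ν = (∏ ι, sa' ν ι) * (α ^ ((su' ν : ℚ) : ℝ) * β ^ ((sv' ν : ℚ) : ℝ))) → (∀ ν, 1 < α ^ ((su' ν : ℚ) : ℝ) * β ^ ((sv' ν : ℚ) : ℝ)) → (∀ ν, (rS' ν).domain = {p : Fin ((n + 1) + 1) → ℝ | (∀ ι : Fin (n + 1), 0 < p (Fin.castSucc ι)) ∧ (∀ k : Fin (n + 1), (sa' ν) k < ∏ j : Fin (n + 1), p (Fin.castSucc j) ^ (sM' ν k j)) ∧ ∏ k : Fin (n + 1), ∏ j : Fin (n + 1), p (Fin.castSucc j) ^ (sM' ν k j) < sc' ν ∧ 0 < p (Fin.last (n + 1)) ∧ p (Fin.last (n + 1)) * ∏ ι : Fin (n + 1), p (Fin.castSucc ι) < 1}) → (∀ ν, ∀ p ∈ (rS' ν).domain, (rS' ν).integrand p = 1) → ∑ ν, (rB ν).value + ∑ ν, (rS ν).value = ∑ ν, (rB'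 ν).value + ∑ ν, (rS' ν).value → (∑ ν, KZ.of (rB ν) + ∑ ν, KZ.of (rS ν)) - (∑ ν, KZ.of (rB' ν) + ∑ ν, KZ.of (rS' ν)) ∈ KZ.relations) := by
  intro hCell hPos n α β hα hβ hαa hβa hind k m k' m' a u v sM sa sc su sv a' u' v' sM' sa' sc'
    su' sv' rB rS rB' rS' ha haa hlt hrBd hrBi hdet hsa hsaa hsca hsc hltS hrSd hrSi ha' ha'a hlt'
    hrB'd hrB'i hdet' hsa' hsa'a hsc'a hsc' hltS' hrS'd hrS'i hv
  obtain ⟨A, U, V, R, hA, hAa, hAlt, hRd, hRi, hRv, hRrel⟩ := bsc_side (hCell n) hα hβ hαa hβa ha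
    haa hlt hrBd hrBi hdet hsa hsaa hsca hsc hltS hrSd hrSi
  obtain ⟨A', U', V', R', hA', hA'a, hA'lt, hR'd, hR'i, hR'v, hR'rel⟩ := bsc_side (hCell n) hα hβ
    hαa hβa ha' ha'a hlt' hrB'd hrB'i hdet' hsa' hsa'a hsc'a hsc' hltS' hrS'd hrS'i
  have hout : ∑ i, KZ.of (R i) - ∑ i, KZ.of (R' i) ∈ KZ.relations :=
    hPos (n + 1) α β hα hβ hαa hβa hind (k + m) (k' + m') A U V A' U' V' R R' hA hAa hAlt hA' hA'a
      hA'lt hRd hRi hR'd hR'i (by rw [hRv, hR'v]; exact hv)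
  have key : (∑ ν, KZ.of (rB ν) + ∑ ν, KZ.of (rS ν)) - (∑ ν, KZ.of (rB' ν) + ∑ ν, KZ.of (rS' ν)) =
      (∑ i, KZ.of (R i) - ∑ i, KZ.of (R' i)) -
        (∑ i, KZ.of (R i) - (∑ ν, KZ.of (rB ν) + ∑ ν, KZ.of (rS ν))) +
        (∑ i, KZ.of (R' i) - (∑ ν, KZ.of (rB' ν) + ∑ ν, KZ.of (rS' ν))) := by
    abel
  rw [key]
  exact KZ.relations.add_mem (KZ.relations.sub_mem hout hRrel) hR'rel

end Summit.KontsevichZagierPeriods.SymplecticScissors.LogPolytope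

end
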